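import Summits.RiemannHypothesis.RiemannHypothesis.Theorems.SpectralTraceWindowTraceArchStubCausalCrystallisation
import Summits.RiemannHypothesis.RiemannHypothesis.Theorems.SpectralTraceWindowTraceArchStubSmearedWindowFormula
import Summits.RiemannHypothesis.RiemannHypothesis.Theorems.SpectralTraceWindowTraceArchStubStructureFunction
import Summits.RiemannHypothesis.RiemannHypothesis.Theorems.SpectralTraceWindowTraceArchStubXiAbsorption
import Summits.RiemannHypothesis.RiemannHypothesis.Theorems.SpectralTraceWindowTraceArchStubXiPhase
import Summits.RiemannHypothesis.RiemannHypothesis.Theorems.SpectralTraceWindowTraceArchStubSmearedIntegrable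
import Literature.NumberTheory.LFunctions.LagariasXiShiftHermiteBiehlerProofs
import Literature.NumberTheory.LFunctions.RiemannXiLogDeriv
import Literature.NumberTheory.LFunctions.WeilExplicitArchTermProofs
import HarnessLib

/-!
# The ξ-carrier trace formula in phase form (`stub_carrierTrace`)

Stub `stub_carrierTrace` of the line `causal-level-sets` for the crux `WindowTraceArch`
(stmt-RiemannHypothesis-11195; skeleton
`Summit.RiemannHypothesis.RiemannHypothesis.Cruxes.WindowTraceArch.CausalLevelSets`).

**Statement.** Let `γ, b : ℕ → ℝ` be a configuration of smeared atoms with widths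
`δ ≤ b_k ≤ B` (`δ > 0`) and `Σ_k 1/(1 + γ_k²) < ∞`, let `h > 1/2` (shift), `L` with `log 2 < 2L`
(tilt) and `α ∈ ℝ` (anchor). Write `ξ = Literature.NumberTheory.LFunctions.riemannXi` for the
completed zeta function, `ĝ(s) = weilMellin g s`, `W = weilFunctional` (the Weil explicit-formula
functional) and `m_h(x) = (1 − e^{−h|x|})(2cosh(x/2) − e^{−|x|/2}/(1 − e^{−2|x|}))`. Then for every
Weil test `g` (`IsWeilTest`) with `tsupport g ⊆ [−log 2, log 2]`, the family `ĝ(1/2 + it)` indexed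
by the real PHASE LEVEL SET
`{t : ∃ m ∈ ℤ, L t + ∫₀ᵗ Re (ξ'/ξ)(1/2 + h + ix) dx + ∫₀ᵗ Σ_k b_k/((x − γ_k)² + b_k²) dx = α + mπ}`
is summable (`HasSum`, unconditionally) with sum
`W(g) − ∫ g(x) m_h(x) dx + 2L g(0) + Σ_k ∫ g(x) e^{iγ_k x − b_k|x|} dx`.

**Proof** (the `E`-half of the composition of the line). Let `E_R` be the structure function of
the configuration (`stub_structureFunction`: Hermite–Biehler, zero-free with polynomially bounded
`E_R'/E_R` on `Im z ≥ −δ/2`, `E_R(t) = |E_R(t)|e^{−iφ_R(t)}`, `φ_R(v) − φ_R(u) = ∫ᵤᵛ Σ_k P_k`), and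
`F(z) = ξ(1/2 + h − iz)`: Hermite–Biehler for `h ≥ 1/2` (Lagarias 2005, Lemma 2.1, tree fact
`lagarias2005_lemma_2_1_holds`), zero-free on `Im z ≥ −(h − 1/2)/2` (`Re(1/2 + h − iz) ≥ 1`) with
`‖F'/F‖ ≤ C(1 + |z|)` there and `F(t) = |F(t)| e^{−iφ_F(t)}`, `φ_F(v) − φ_F(u) = ∫ᵤᵛ Re ξ'/ξ(1/2+h+it) dt`
(`stub_xiPhase`); moreover `−Im (F'/F)(t) = Re (ξ'/ξ)(1/2 + h + it)` (`F'(t) = −iξ'(s̄)`, `s = 1/2+h+it`,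
`ξ'/ξ(s̄) = conj ξ'/ξ(s)`: `logDeriv_riemannXi_conj`). The product `E = F · E_R` is Hermite–Biehler,
zero-free with polynomially bounded `E'/E` on `Im z ≥ −δ'`, `δ' = min(δ/2, (h − 1/2)/2)`, and
`E(t) = |E(t)| e^{−i(φ_F + φ_R)(t)}`, so `Im (e^{i(α' − Lt)} E(t)) = 0 ⟺ L t + φ_F(t) + φ_R(t) ∈ α' + πℤ`;
with `α' = α + φ_F(0) + φ_R(0)` this is the phase level set of the statement. The causal
crystallisation `stub_causalCrystallisation` (tilt `L > (log 2)/2`) sums `ĝ(1/2 + it)` over it to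
`(1/π) ∫ ĝ(1/2 + it)(L − Im E'/E(t)) dt = (1/π) ∫ ĝ (L + Σ_k P_k) + (1/π) ∫ ĝ Re ξ'/ξ(1/2 + h + it)`
(both pieces integrable: `stub_smearedIntegrable`, linear growth of `ξ'/ξ`), i.e. to
`2L g(0) + Σ_k ∫ g e^{iγ_k x − b_k|x|}` (`stub_smearedWindowFormula`) plus `W(g) − ∫ g m_h`
(`stub_xiAbsorption`); finally the sum is transported along the equivalence of the two index subtypes.

**Sources.** J. C. Lagarias, *Hilbert spaces of entire functions and Dirichlet L-functions*,
in: Frontiers in Number Theory, Physics and Geometry I (2006), Lemma 2.1 (tree: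
`Literature/NumberTheory/LFunctions/LagariasXiShiftHermiteBiehler*.lean`); L. de Branges,
*Hilbert Spaces of Entire Functions* (1968), §§19–22 (phase functions and level sets). All
ingredients are proved tree / Mathlib facts (the sibling stubs of this line).
-/

set_option linter.dupNamespace false

noncomputable section

open Complex Set MeasureTheory Filter
open scoped Real Topology

namespace Summit.RiemannHypothesis.RiemannHypothesis.Theorems.SpectralTraceWindowTraceArch

open Literature.NumberTheory.LFunctions
open Literature.Analysis.DeBrangesSpaces (IsHermiteBiehler sharp)

/-- Level-set membership is phase integrality: if `E(t) = |E(t)| e^{-iφ(t)}` with `E(t) ≠ 0`, then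
`Im (e^{i(α - Lt)} E(t)) = 0 ↔ ∃ n : ℤ, L t + φ t = α + n π`. -/
theorem carrierTrace_im_tilt_eq_zero_iff {E : ℂ → ℂ} {φ : ℝ → ℝ} {α L t : ℝ}
    (hpolar : E t = ((‖E t‖ : ℝ) : ℂ) * cexp (-(((φ t : ℝ) : ℂ) * I))) (hne : E t ≠ 0) :
    (cexp (((α - L * t : ℝ) : ℂ) * I) * E t).im = 0 ↔ ∃ n : ℤ, L * t + φ t = α + n * π := by
  have e : cexp (((α - L * t : ℝ) : ℂ) * I) * E t =
      ((‖E t‖ : ℝ) : ℂ) * cexp (((α - L * t - φ t : ℝ) : ℂ) * I) := by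
    conv_lhs => rw [hpolar]
    rw [mul_left_comm, ← Complex.exp_add]
    congr 2
    push_cast
    ring
  rw [e, Complex.im_ofReal_mul, Complex.exp_ofReal_mul_I_im]
  have hn : ‖E t‖ ≠ 0 := norm_ne_zero_iff.2 hne
  constructor
  · intro h0
    have hs : Real.sin (α - L * t - φ t) = 0 := by
      rcases mul_eq_zero.1 h0 with h | h
      · exact absurd h hn
      · exact h
    obtain ⟨n, hn'⟩ := Real.sin_eq_zero_iff.1 hs
    exact ⟨-n, by push_cast; linarith⟩
  · rintro ⟨n, hn'⟩
    have : α - L * t - φ t = ((-n : ℤ) : ℝ) * π := by push_cast; linarith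
    rw [this, Real.sin_int_mul_pi, mul_zero]

/-- Product of Hermite–Biehler functions is Hermite–Biehler. -/
theorem carrierTrace_isHermiteBiehler_mul {E F : ℂ → ℂ} (hE : IsHermiteBiehler E)
    (hF : IsHermiteBiehler F) : IsHermiteBiehler (fun z => E z * F z) where
  differentiable := hE.differentiable.mul hF.differentiable
  norm_conj_lt := fun z hz => by
    simp only [norm_mul]
    exact mul_lt_mul'' (hE.norm_conj_lt z hz) (hF.norm_conj_lt z hz) (norm_nonneg _) (norm_nonneg _)

/-- The shifted ξ, `F_h(z) = ξ(1/2 + h − iz)`, is Hermite–Biehler for `h ≥ 1/2` (Lagarias 2005,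
Lemma 2.1, proved in the tree: `lagarias2005_lemma_2_1_holds`). -/
theorem carrierTrace_isHermiteBiehler_xiShift {h : ℝ} (hh : 1 / 2 ≤ h) :
    IsHermiteBiehler (fun z : ℂ => riemannXi (1 / 2 + h - I * z)) where
  differentiable := differentiable_riemannXi.comp
    ((differentiable_const _).sub ((differentiable_const _).mul differentiable_id))
  norm_conj_lt := fun _ hz =>
    lagarias2005_lemma_2_1.structureFunction lagarias2005_lemma_2_1_holds hh hz

/-! ### The ξ factor `F(z) = ξ(1/2 + h − iz)` -/

/-- **The ξ factor as an abstract carrier.** For `h > 1/2` there are a Hermite–Biehler function `F`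
(namely `F(z) = ξ(1/2 + h − iz)`), a phase `φ` and a constant `C` with: `F` zero-free on
`Im z ≥ −(h − 1/2)/2`; `‖F'/F(z)‖ ≤ C (1 + |z|)` there; `F(t) = |F(t)| e^{−iφ(t)}` on `ℝ`;
phase density `−Im (F'/F)(t) = Re (ξ'/ξ)(1/2 + h + it)`; and
`φ(v) − φ(u) = ∫ᵤᵛ Re (ξ'/ξ)(1/2 + h + it) dt`. -/
theorem carrierTrace_xiFactor {h : ℝ} (hh : 1 / 2 < h) :
    ∃ (F : ℂ → ℂ) (φ : ℝ → ℝ) (C : ℝ), IsHermiteBiehler F ∧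
      (∀ z : ℂ, -((h - 1 / 2) / 2) ≤ z.im → F z ≠ 0) ∧
      (∀ z : ℂ, -((h - 1 / 2) / 2) ≤ z.im → ‖deriv F z / F z‖ ≤ C * (1 + ‖z‖)) ∧
      (∀ t : ℝ, F t = ((‖F t‖ : ℝ) : ℂ) * cexp (-(((φ t : ℝ) : ℂ) * I))) ∧
      (∀ t : ℝ, -(deriv F t / F t).im =
        (deriv riemannXi (1 / 2 + h + t * I) / riemannXi (1 / 2 + h + t * I)).re) ∧
      (∀ u v : ℝ, φ v - φ u =
        ∫ t in u..v, (deriv riemannXi (1 / 2 + h + t * I) / riemannXi (1 / 2 + h + t * I)).re) := by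
  obtain ⟨⟨CF, hCF⟩, ⟨φF, hpolF, hphF⟩⟩ := stub_xiPhase h hh
  set F : ℂ → ℂ := fun z => riemannXi (1 / 2 + h - I * z) with hFdef
  have hreF : ∀ z : ℂ, (1 / 2 + (h : ℂ) - I * z).re = 1 / 2 + h + z.im := by
    intro z; simp
  -- derivative of the ξ factor (chain rule)
  have hFderiv : ∀ z : ℂ, deriv F z = deriv riemannXi (1 / 2 + h - I * z) * (-I) := by
    intro z
    have h1 : HasDerivAt (fun w : ℂ => 1 / 2 + (h : ℂ) - I * w) (-I) z := by
      simpa using ((hasDerivAt_id z).const_mul I).const_sub (1 / 2 + (h : ℂ))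
    have h2 : HasDerivAt riemannXi (deriv riemannXi (1 / 2 + h - I * z)) (1 / 2 + h - I * z) :=
      (differentiable_riemannXi _).hasDerivAt
    exact (h2.comp z h1).deriv
  refine ⟨F, φF, |CF| * (3 / 2 + h), carrierTrace_isHermiteBiehler_xiShift hh.le, ?_, ?_, hpolF,
    ?_, hphF⟩
  · -- zero-freeness: `Re (1/2 + h - iz) = 1/2 + h + Im z ≥ 1`
    intro z hz
    apply riemannXi_ne_zero_of_one_le_re
    rw [hreF]
    linarith
  · -- linear growth of `F'/F` on the strip
    intro z hz
    have hs : 3 / 4 + h / 2 ≤ (1 / 2 + (h : ℂ) - I * z).re := by rw [hreF]; linarith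
    have hFz : F z = riemannXi (1 / 2 + h - I * z) := rfl
    rw [hFderiv, hFz, norm_div, norm_mul, norm_neg, Complex.norm_I, mul_one, ← norm_div]
    calc ‖deriv riemannXi (1 / 2 + ↑h - I * z) / riemannXi (1 / 2 + ↑h - I * z)‖
        ≤ CF * (1 + ‖1 / 2 + (h : ℂ) - I * z‖) := hCF _ hs
      _ ≤ |CF| * (1 + ‖1 / 2 + (h : ℂ) - I * z‖) :=
          mul_le_mul_of_nonneg_right (le_abs_self _) (by positivity)
      _ ≤ |CF| * ((3 / 2 + h) * (1 + ‖z‖)) := by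
          apply mul_le_mul_of_nonneg_left _ (abs_nonneg _)
          have : ‖1 / 2 + (h : ℂ) - I * z‖ ≤ ‖(1 / 2 + (h : ℂ))‖ + ‖I * z‖ := norm_sub_le _ _
          have h2 : ‖(1 / 2 + (h : ℂ))‖ = 1 / 2 + h := by
            rw [show (1 / 2 + (h : ℂ)) = ((1 / 2 + h : ℝ) : ℂ) by push_cast; ring, Complex.norm_real,
              Real.norm_eq_abs, abs_of_pos (by linarith)]
          rw [norm_mul, Complex.norm_I, one_mul, h2] at this
          nlinarith [norm_nonneg z]
      _ = |CF| * (3 / 2 + h) * (1 + ‖z‖) := by ring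
  · -- phase density of the ξ factor on the real line
    intro t
    have hFt : F t = riemannXi (1 / 2 + h - I * t) := rfl
    rw [hFderiv, hFt]
    have hc : (1 / 2 + (h : ℂ) - I * t) = (starRingEnd ℂ) (1 / 2 + h + t * I) := by
      apply Complex.ext <;> simp
    rw [hc, show deriv riemannXi ((starRingEnd ℂ) (1 / 2 + ↑h + ↑t * I)) * -I /
        riemannXi ((starRingEnd ℂ) (1 / 2 + ↑h + ↑t * I)) =
        -I * logDeriv riemannXi ((starRingEnd ℂ) (1 / 2 + ↑h + ↑t * I)) by
          rw [logDeriv_apply]; ring,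
      logDeriv_riemannXi_conj, logDeriv_apply]
    simp [Complex.mul_im]
    rw [← map_div₀, Complex.conj_re]

/-- **Integrability of `ĝ(1/2 + it) · Re (ξ'/ξ)(1/2 + h + it)`** for `h > 1/2` and a Weil test `g`
(linear growth of `ξ'/ξ` on `Re s ≥ 3/4 + h/2`, `stub_xiPhase` (i), against the decay of `ĝ`:
`integrable_mul_weilMellin_vertical_of_norm_le_linear`). -/
theorem carrierTrace_xiIntegrable {h : ℝ} (hh : 1 / 2 < h) {g : ℝ → ℂ} (hg : IsWeilTest g) :
    Integrable (fun t : ℝ => weilMellin g (1 / 2 + (t : ℂ) * I) *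
      (((deriv riemannXi (1 / 2 + h + t * I) / riemannXi (1 / 2 + h + t * I)).re : ℝ) : ℂ)) := by
  obtain ⟨⟨CF, hCF⟩, -⟩ := stub_xiPhase h hh
  have hc : Continuous fun y : ℝ =>
      (((deriv riemannXi (1 / 2 + h + y * I) / riemannXi (1 / 2 + h + y * I)).re : ℝ) : ℂ) := by
    have h1 : Continuous fun y : ℝ => logDeriv riemannXi (((1 / 2 + h : ℝ) : ℂ) + y * I) :=
      continuous_logDeriv_riemannXi_vertical (by linarith)
    have h2 : (fun y : ℝ => (((deriv riemannXi (1 / 2 + h + y * I) / riemannXi (1 / 2 + h + y * I)).re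
        : ℝ) : ℂ)) =
        fun y : ℝ => (((logDeriv riemannXi (((1 / 2 + h : ℝ) : ℂ) + (y : ℂ) * I)).re : ℝ) : ℂ) := by
      funext y; rw [logDeriv_apply]; push_cast; ring_nf
    rw [h2]
    exact Complex.continuous_ofReal.comp (Complex.continuous_re.comp h1)
  have hb : ∀ y : ℝ, ‖(((deriv riemannXi (1 / 2 + h + y * I) / riemannXi (1 / 2 + h + y * I)).re
      : ℝ) : ℂ)‖ ≤ |CF| * (3 / 2 + h) * (1 + |y|) := by
    intro y
    rw [Complex.norm_real, Real.norm_eq_abs]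
    have hs : 3 / 4 + h / 2 ≤ (1 / 2 + (h : ℂ) + y * I).re := by simp; linarith
    calc |(deriv riemannXi (1 / 2 + ↑h + ↑y * I) / riemannXi (1 / 2 + ↑h + ↑y * I)).re|
        ≤ ‖deriv riemannXi (1 / 2 + ↑h + ↑y * I) / riemannXi (1 / 2 + ↑h + ↑y * I)‖ :=
          Complex.abs_re_le_norm _
      _ ≤ CF * (1 + ‖1 / 2 + (h : ℂ) + y * I‖) := hCF _ hs
      _ ≤ |CF| * (1 + ‖1 / 2 + (h : ℂ) + y * I‖) :=
          mul_le_mul_of_nonneg_right (le_abs_self _) (by positivity)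
      _ ≤ |CF| * ((3 / 2 + h) * (1 + |y|)) := by
          apply mul_le_mul_of_nonneg_left _ (abs_nonneg _)
          have : ‖1 / 2 + (h : ℂ) + y * I‖ ≤ ‖(1 / 2 + (h : ℂ))‖ + ‖(y : ℂ) * I‖ := norm_add_le _ _
          have h2 : ‖(1 / 2 + (h : ℂ))‖ = 1 / 2 + h := by
            rw [show (1 / 2 + (h : ℂ)) = ((1 / 2 + h : ℝ) : ℂ) by push_cast; ring, Complex.norm_real,
              Real.norm_eq_abs, abs_of_pos (by linarith)]
          rw [norm_mul, Complex.norm_I, mul_one, h2, Complex.norm_real, Real.norm_eq_abs] at this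
          nlinarith [abs_nonneg y]
      _ = |CF| * (3 / 2 + h) * (1 + |y|) := by ring
  have := integrable_mul_weilMellin_vertical_of_norm_le_linear hg (1 / 2) hc hb
  refine this.congr (Eventually.of_forall fun y => ?_)
  simp only [Complex.ofReal_div, Complex.ofReal_one, Complex.ofReal_ofNat]
  ring

/-- **stub_carrierTrace — the ξ-carrier trace formula in phase form.** For a smeared configuration
`R = (γ, b)` (widths in `[δ, B]`, `δ > 0`, `Σ 1/(1+γ²) < ∞`), `h > 1/2`, `log 2 < 2L`, `α ∈ ℝ`: the real
set `{t : ∃ m : ℤ, L t + ∫₀ᵗ Re ξ'/ξ(1/2+h+ix) dx + ∫₀ᵗ Σ_k b_k/((x−γ_k)²+b_k²) dx = α + mπ}` (the level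
set `Im (e^{i(α'−Lt)} ξ(1/2+h−it) E_R(t)) = 0`, `α' = α + φ_F(0) + φ_R(0)`) sums `ĝ(1/2+it)` (`HasSum`)
to `W(g) − ∫ g m_h + 2L g(0) + Σ_k ∫ g(x) e^{iγ_k x − b_k|x|} dx` for every Weil test `g` supported in
`[−log 2, log 2]` (stubs `causalCrystallisation`, `smearedIntegrable`, `smearedWindowFormula`, `xiAbsorption`). -/
theorem stub_carrierTrace :
    ∀ (γ b : ℕ → ℝ) (δ B h L α : ℝ), 0 < δ → (∀ k, δ ≤ b k ∧ b k ≤ B) →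
      Summable (fun k => 1 / (1 + (γ k) ^ 2)) → 1 / 2 < h → Real.log 2 < 2 * L →
      ∀ g : ℝ → ℂ, IsWeilTest g → tsupport g ⊆ Icc (-Real.log 2) (Real.log 2) →
        HasSum
          (fun l : {t : ℝ // ∃ m : ℤ, L * t + (∫ x in (0 : ℝ)..t,
              (deriv riemannXi (1 / 2 + h + x * I) / riemannXi (1 / 2 + h + x * I)).re)
                + (∫ x in (0 : ℝ)..t, ∑' k, b k / ((x - γ k) ^ 2 + (b k) ^ 2)) = α + m * π} =>
            weilMellin g (1 / 2 + ((l : ℝ) : ℂ) * I))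
          (weilFunctional g
            - (∫ x : ℝ, g x *
                (((1 - Real.exp (-(h * |x|))) *
                  (2 * Real.cosh (x / 2) - Real.exp (-(|x| / 2)) / (1 - Real.exp (-(2 * |x|)))) : ℝ) : ℂ))
            + 2 * L * g 0
            + ∑' k, ∫ x : ℝ, g x * cexp (((γ k * x : ℝ) : ℂ) * I) * ((Real.exp (-(b k * |x|)) : ℝ) : ℂ)) := by
  intro γ b δ B h L α hδ hb hγ hh hL g hg hgs
  classical
  obtain ⟨ER, φR, CR, NR, hER, hzR, hgR, hpolR, hdensR, hphR⟩ :=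
    stub_structureFunction γ b δ B hδ hb hγ
  obtain ⟨F, φF, CF, hFB, hzF, hgF, hpolF, hdensF, hphF⟩ := carrierTrace_xiFactor hh
  -- the product structure function
  set E : ℂ → ℂ := fun z => F z * ER z with hEdef
  have hEB : IsHermiteBiehler E := carrierTrace_isHermiteBiehler_mul hFB hER
  -- the strip `Im z ≥ -δ'`
  set δ' : ℝ := min (δ / 2) ((h - 1 / 2) / 2) with hδ'def
  have hδ'pos : 0 < δ' := lt_min (half_pos hδ) (by linarith)
  obtain ⟨hδ'1, hδ'2⟩ : δ' ≤ δ / 2 ∧ δ' ≤ (h - 1 / 2) / 2 := ⟨min_le_left _ _, min_le_right _ _⟩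
  have hFne : ∀ z : ℂ, -δ' ≤ z.im → F z ≠ 0 := fun z hz => hzF z (by linarith)
  have hERne : ∀ z : ℂ, -δ' ≤ z.im → ER z ≠ 0 := fun z hz => hzR z (by linarith)
  have hEne : ∀ z : ℂ, -δ' ≤ z.im → E z ≠ 0 := fun z hz => mul_ne_zero (hFne z hz) (hERne z hz)
  -- log-derivative of the product
  have hElog : ∀ z : ℂ, -δ' ≤ z.im →
      deriv E z / E z = deriv F z / F z + deriv ER z / ER z := by
    intro z hz
    have hd : deriv E z = deriv F z * ER z + F z * deriv ER z :=
      deriv_mul (hFB.differentiable z) (hER.differentiable z)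
    have hEz : E z = F z * ER z := rfl
    rw [hd, hEz]
    field_simp [hFne z hz, hERne z hz]
  -- growth of `E'/E` on the strip
  have hgrowth : ∀ z : ℂ, -δ' ≤ z.im →
      ‖deriv E z / E z‖ ≤ (|CF| + |CR|) * (1 + ‖z‖) ^ (NR + 1) := by
    intro z hz
    rw [hElog z hz]
    have h1 : ‖deriv F z / F z‖ ≤ |CF| * (1 + ‖z‖) :=
      (hgF z (by linarith)).trans (mul_le_mul_of_nonneg_right (le_abs_self _) (by positivity))
    have h2 : ‖deriv ER z / ER z‖ ≤ |CR| * (1 + ‖z‖) ^ NR :=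
      (hgR z (by linarith)).trans (mul_le_mul_of_nonneg_right (le_abs_self _) (by positivity))
    have hb1 : 1 ≤ 1 + ‖z‖ := by linarith [norm_nonneg z]
    have hp1 : (1 + ‖z‖) ≤ (1 + ‖z‖) ^ (NR + 1) := le_self_pow₀ hb1 (by omega)
    have hp2 : (1 + ‖z‖) ^ NR ≤ (1 + ‖z‖) ^ (NR + 1) := pow_le_pow_right₀ hb1 (by omega)
    calc ‖deriv F z / F z + deriv ER z / ER z‖
        ≤ ‖deriv F z / F z‖ + ‖deriv ER z / ER z‖ := norm_add_le _ _
      _ ≤ |CF| * (1 + ‖z‖) + |CR| * (1 + ‖z‖) ^ NR := add_le_add h1 h2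
      _ ≤ |CF| * (1 + ‖z‖) ^ (NR + 1) + |CR| * (1 + ‖z‖) ^ (NR + 1) := by gcongr
      _ = (|CF| + |CR|) * (1 + ‖z‖) ^ (NR + 1) := by ring
  -- polar form of `E` on the real line
  have hpolE : ∀ t : ℝ, E t = ((‖E t‖ : ℝ) : ℂ) * cexp (-((((φF t + φR t : ℝ)) : ℂ) * I)) := by
    intro t
    show F t * ER t = ((‖F t * ER t‖ : ℝ) : ℂ) * cexp (-((((φF t + φR t : ℝ)) : ℂ) * I))
    conv_lhs => rw [hpolF t, hpolR t]
    rw [norm_mul]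
    push_cast
    rw [show -((↑(φF t) + ↑(φR t)) * I) = -(↑(φF t) * I) + -(↑(φR t) * I) by ring, Complex.exp_add]
    ring
  -- the level-set predicate in phase form
  set α' : ℝ := α + φF 0 + φR 0 with hα'
  have hPE : ∀ t : ℝ, (cexp (((α' - L * t : ℝ) : ℂ) * I) * E t).im = 0 ↔ ∃ m : ℤ,
      L * t + (∫ x in (0 : ℝ)..t, (deriv riemannXi (1 / 2 + h + x * I) / riemannXi (1 / 2 + h + x * I)).re)
        + (∫ x in (0 : ℝ)..t, ∑' k, b k / ((x - γ k) ^ 2 + (b k) ^ 2)) = α + m * π := by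
    intro t
    rw [carrierTrace_im_tilt_eq_zero_iff (φ := fun t => φF t + φR t) (hpolE t)
      (hEne t (by simp; linarith)), ← hphF 0 t, ← hphR 0 t, hα']
    constructor <;> rintro ⟨n, hn⟩ <;> exact ⟨n, by linarith⟩
  -- STUB 1 for `E`
  have hclsE := stub_causalCrystallisation E L δ' _ _ hEB hδ'pos hEne hgrowth α' (Real.log 2) hL g hg hgs
  -- evaluate the `E` integral: split, stub 2, stub 4a
  have h2R := stub_smearedWindowFormula γ b δ B L hδ hb hγ g hg
  have h4a := stub_xiAbsorption h hh g hg hgs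
  have hI1 := stub_smearedIntegrable γ b δ B L hδ hb hγ g hg
  have hI2 := carrierTrace_xiIntegrable hh hg
  have hintE : (fun t : ℝ => weilMellin g (1 / 2 + (t : ℂ) * I) *
      (((L - (deriv E t / E t).im : ℝ)) : ℂ)) =
      fun t : ℝ => weilMellin g (1 / 2 + (t : ℂ) * I) *
          (((L + ∑' k, b k / ((t - γ k) ^ 2 + (b k) ^ 2) : ℝ)) : ℂ) +
        weilMellin g (1 / 2 + (t : ℂ) * I) *
          (((deriv riemannXi (1 / 2 + h + t * I) / riemannXi (1 / 2 + h + t * I)).re : ℝ) : ℂ) := by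
    funext t
    have : (deriv E t / E t).im = (deriv F t / F t).im + (deriv ER t / ER t).im := by
      rw [hElog t (by simp; linarith), Complex.add_im]
    rw [this, ← mul_add]
    congr 1
    have e3 : L - ((deriv F t / F t).im + (deriv ER t / ER t).im) =
        (L + ∑' k, b k / ((t - γ k) ^ 2 + (b k) ^ 2)) +
          (deriv riemannXi (1 / 2 + h + t * I) / riemannXi (1 / 2 + h + t * I)).re := by
      rw [← hdensF t, ← hdensR t]; ring
    rw [e3, Complex.ofReal_add]
  rw [hintE, integral_add hI1 hI2, mul_add] at hclsE
  set TR : ℂ := ∑' k, ∫ x : ℝ, g x * cexp (((γ k * x : ℝ) : ℂ) * I) *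
    ((Real.exp (-(b k * |x|)) : ℝ) : ℂ) with hTR
  set Mh : ℂ := ∫ x : ℝ, g x * (((1 - Real.exp (-(h * |x|))) *
    (2 * Real.cosh (x / 2) - Real.exp (-(|x| / 2)) / (1 - Real.exp (-(2 * |x|)))) : ℝ) : ℂ) with hMh
  have hVR : (1 / (π : ℂ)) * (∫ t : ℝ, weilMellin g (1 / 2 + (t : ℂ) * I) *
      (((L + ∑' k, b k / ((t - γ k) ^ 2 + (b k) ^ 2) : ℝ)) : ℂ)) = TR + 2 * L * g 0 := by
    rw [hTR, h2R.tsum_eq]; ring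
  rw [hVR, h4a, show TR + 2 * L * g 0 + (weilFunctional g - Mh) =
    weilFunctional g - Mh + 2 * L * g 0 + TR by ring] at hclsE
  -- transport along the equivalence of the two index subtypes
  exact (Equiv.hasSum_iff (Equiv.subtypeEquivRight hPE)).1 hclsE

/-! ### Bonus: the bare ξ-carrier (no configuration) -/

/-- **The bare ξ-carrier trace formula.** For `h > 1/2`, `log 2 < 2L`, `α ∈ ℝ` and every Weil test
`g` supported in `[−log 2, log 2]`, the phase level set `{t : ∃ m : ℤ, L t + ∫₀ᵗ Re ξ'/ξ(1/2+h+ix) dx = α + mπ}`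
of the tilted Hermite–Biehler function `e^{−iLz} ξ(1/2 + h − iz)` sums `ĝ(1/2 + it)` to
`W(g) − ∫ g m_h + 2L g(0)` (`stub_causalCrystallisation` for `F = ξ(1/2 + h − iz)` alone, Mellin inversion
`∫ ĝ(1/2 + it) dt = 2π g(0)` and `stub_xiAbsorption`). -/
theorem xiCarrierTrace {h L α : ℝ} (hh : 1 / 2 < h) (hL : Real.log 2 < 2 * L) {g : ℝ → ℂ}
    (hg : IsWeilTest g) (hgs : tsupport g ⊆ Icc (-Real.log 2) (Real.log 2)) :
    HasSum
      (fun l : {t : ℝ // ∃ m : ℤ, L * t + (∫ x in (0 : ℝ)..t,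
          (deriv riemannXi (1 / 2 + h + x * I) / riemannXi (1 / 2 + h + x * I)).re) = α + m * π} =>
        weilMellin g (1 / 2 + ((l : ℝ) : ℂ) * I))
      (weilFunctional g
        - (∫ x : ℝ, g x *
            (((1 - Real.exp (-(h * |x|))) *
              (2 * Real.cosh (x / 2) - Real.exp (-(|x| / 2)) / (1 - Real.exp (-(2 * |x|)))) : ℝ) : ℂ))
        + 2 * L * g 0) := by
  classical
  obtain ⟨F, φ, C, hFB, hzF, hgF, hpol, hdens, hph⟩ := carrierTrace_xiFactor hh
  have hδ : 0 < (h - 1 / 2) / 2 := by linarith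
  have hgF' : ∀ z : ℂ, -((h - 1 / 2) / 2) ≤ z.im → ‖deriv F z / F z‖ ≤ C * (1 + ‖z‖) ^ 1 :=
    fun z hz => by rw [pow_one]; exact hgF z hz
  -- the level-set predicate in phase form
  have hP : ∀ t : ℝ, (cexp (((α + φ 0 - L * t : ℝ) : ℂ) * I) * F t).im = 0 ↔ ∃ m : ℤ,
      L * t + (∫ x in (0 : ℝ)..t,
        (deriv riemannXi (1 / 2 + h + x * I) / riemannXi (1 / 2 + h + x * I)).re) = α + m * π := by
    intro t
    rw [carrierTrace_im_tilt_eq_zero_iff (hpol t) (hzF t (by simp; linarith)), ← hph 0 t]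
    constructor <;> rintro ⟨n, hn⟩ <;> exact ⟨n, by linarith⟩
  -- STUB 1 for `F`
  have hcls := stub_causalCrystallisation F L _ C 1 hFB hδ hzF hgF' (α + φ 0) (Real.log 2) hL g hg hgs
  -- evaluate the integral: split, Mellin inversion, stub 4a
  have hI0 : Integrable (fun t : ℝ => weilMellin g (1 / 2 + (t : ℂ) * I) * ((L : ℝ) : ℂ)) := by
    refine ((integrable_weilMellin_vertical hg (1 / 2)).mul_const (L : ℂ)).congr
      (Eventually.of_forall fun y => ?_)
    simp only [Complex.ofReal_div, Complex.ofReal_one, Complex.ofReal_ofNat]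
  have hI2 := carrierTrace_xiIntegrable hh hg
  have hint : (fun t : ℝ => weilMellin g (1 / 2 + (t : ℂ) * I) *
      (((L - (deriv F t / F t).im : ℝ)) : ℂ)) =
      fun t : ℝ => weilMellin g (1 / 2 + (t : ℂ) * I) * ((L : ℝ) : ℂ) +
        weilMellin g (1 / 2 + (t : ℂ) * I) *
          (((deriv riemannXi (1 / 2 + h + t * I) / riemannXi (1 / 2 + h + t * I)).re : ℝ) : ℂ) := by
    funext t
    rw [sub_eq_add_neg, hdens t, Complex.ofReal_add, mul_add]
  have h0 : ∫ t : ℝ, weilMellin g (1 / 2 + (t : ℂ) * I) * ((L : ℝ) : ℂ) = 2 * π * g 0 * L := by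
    rw [integral_mul_const]
    congr 1
    have := integral_weilMellin_vertical hg (1 / 2)
    simp only [Complex.ofReal_div, Complex.ofReal_one, Complex.ofReal_ofNat] at this
    exact this
  rw [hint, integral_add hI0 hI2, mul_add, h0, stub_xiAbsorption h hh g hg hgs] at hcls
  set Mh : ℂ := ∫ x : ℝ, g x * (((1 - Real.exp (-(h * |x|))) *
    (2 * Real.cosh (x / 2) - Real.exp (-(|x| / 2)) / (1 - Real.exp (-(2 * |x|)))) : ℝ) : ℂ) with hMh
  have hπ : (π : ℂ) ≠ 0 := Complex.ofReal_ne_zero.2 Real.pi_ne_zero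
  rw [show 1 / (π : ℂ) * (2 * π * g 0 * L) + (weilFunctional g - Mh) =
      weilFunctional g - Mh + 2 * L * g 0 by field_simp; ring] at hcls
  -- transport along the equivalence of the two index subtypes
  exact (Equiv.hasSum_iff (Equiv.subtypeEquivRight hP)).1 hcls

end Summit.RiemannHypothesis.RiemannHypothesis.Theorems.SpectralTraceWindowTraceArch

end
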